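import Summits.CriticalPhenomena.SAWScalingLimit.Theorems.LeftRightFKG.Negative.LatticePolylines
import HarnessLib

/-!
# Negative knowledge on crux `LeftRightFKG`, part 3: the box `{0..4} × {0..3}` as `Ω = {wind(C,·) ≠ 0}`

`Cwalk` = the boundary walk of `[-1,5] × [-1,4]`; `Ωb` = the crux's domain built from it (`δ = 1`);
**`meshVertices_Ωb`**: its mesh vertices are exactly the `5 × 4` box of sites (inside: index `1` by the
crossing formula of part 2 and `wind_sub_eq_of_mem_connectedComponentIn`; lattice points of the boundary:
junk `0`; outside the closed rectangle: `wind_sub_eq_zero_of_joined`). [folklore]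
-/

noncomputable section

open Real Set Complex Literature.Probability.LatticeModels Literature.Probability.RandomPlanarGeometry
  Literature.Topology.PlaneTopology

namespace Summit.CriticalPhenomena.SAWScalingLimit.Theorems.LeftRightFKG.Negative

/-! ## The witness domain: the `5 × 4` box of sites as `Ω = {wind(C, ·) ≠ 0}` -/

section BoxDomain

/-- The site `(i, j)`. [folklore] -/
def bx (i j : ℤ) : Site 2 := ![i, j]

/-- `bx_zero` (auxiliary). [folklore] -/
@[simp] theorem bx_zero (i j : ℤ) : bx i j 0 = i := rfl
/-- `bx_one` (auxiliary). [folklore] -/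
@[simp] theorem bx_one (i j : ℤ) : bx i j 1 = j := rfl

/-- `eq_bx` (auxiliary). [folklore] -/
theorem eq_bx (x : Site 2) : x = bx (x 0) (x 1) := by
  ext k; fin_cases k <;> rfl

/-- Adjacency of explicit sites, decided numerically. [folklore] -/
theorem adj_bx (i j i' j' : ℤ) (h : (i' = i + 1 ∧ j' = j) ∨ (i = i' + 1 ∧ j' = j) ∨
    (j' = j + 1 ∧ i' = i) ∨ (j = j' + 1 ∧ i' = i)) : (zdGraph 2).Adj (bx i j) (bx i' j') := by
  rw [zdGraph_adj_iff]
  rcases h with ⟨h1, h2⟩ | ⟨h1, h2⟩ | ⟨h1, h2⟩ | ⟨h1, h2⟩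
  · exact ⟨0, Or.inl (by ext k; fin_cases k <;> simp [bx, h1, h2])⟩
  · exact ⟨0, Or.inr (by ext k; fin_cases k <;> simp [bx, h1, h2])⟩
  · exact ⟨1, Or.inl (by ext k; fin_cases k <;> simp [bx, h1, h2])⟩
  · exact ⟨1, Or.inr (by ext k; fin_cases k <;> simp [bx, h1, h2])⟩

/-- The corner `(-1, -1)`. [folklore] -/
abbrev c₀ : Site 2 := bx (-1) (-1)

/-- **The boundary walk** of the rectangle `[-1, 5] × [-1, 4]`, counterclockwise from `(-1,-1)`
(22 unit steps). [folklore] -/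
def Cwalk : (zdGraph 2).Walk c₀ c₀ :=
  SimpleGraph.Walk.cons (adj_bx (-1) (-1) 0 (-1) (by decide)) (SimpleGraph.Walk.cons (adj_bx 0 (-1) 1 (-1) (by decide)) (SimpleGraph.Walk.cons (adj_bx 1 (-1) 2 (-1) (by decide)) (SimpleGraph.Walk.cons (adj_bx 2 (-1) 3 (-1) (by decide)) (SimpleGraph.Walk.cons (adj_bx 3 (-1) 4 (-1) (by decide)) (SimpleGraph.Walk.cons (adj_bx 4 (-1) 5 (-1) (by decide)) (SimpleGraph.Walk.cons (adj_bx 5 (-1) 5 0 (by decide)) (SimpleGraph.Walk.cons (adj_bx 5 0 5 1 (by decide)) (SimpleGraph.Walk.cons (adj_bx 5 1 5 2 (by decide)) (SimpleGraph.Walk.cons (adj_bx 5 2 5 3 (by decide)) (SimpleGraph.Walk.cons (adj_bx 5 3 5 4 (by decide)) (SimpleGraph.Walk.cons (adj_bx 5 4 4 4 (by decide)) (SimpleGraph.Walk.cons (adj_bx 4 4 3 4 (by decide)) (SimpleGraph.Walk.cons (adj_bx 3 4 2 4 (by decide)) (SimpleGraph.Walk.cons (adj_bx 2 4 1 4 (by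 decide)) (SimpleGraph.Walk.cons (adj_bx 1 4 0 4 (by decide)) (SimpleGraph.Walk.cons (adj_bx 0 4 (-1) 4 (by decide)) (SimpleGraph.Walk.cons (adj_bx (-1) 4 (-1) 3 (by decide)) (SimpleGraph.Walk.cons (adj_bx (-1) 3 (-1) 2 (by decide)) (SimpleGraph.Walk.cons (adj_bx (-1) 2 (-1) 1 (by decide)) (SimpleGraph.Walk.cons (adj_bx (-1) 1 (-1) 0 (by decide)) (SimpleGraph.Walk.cons (adj_bx (-1) 0 (-1) (-1) (by decide)) (SimpleGraph.Walk.nil))))))))))))))))))))))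

/-- The witness domain `Ω = {z | wind(C − z) ≠ 0}` exactly as the crux builds it (`δ = 1`). [folklore] -/
def Ωb : Set ℂ :=
  {z | wind (fun t : ℝ => Set.IccExtend zero_le_one (Cwalk.toCurve (meshPoint 1)) t - z) ≠ 0}

/-- The open rectangle `(-1, 5) × (-1, 4)`. [folklore] -/
def Rint : Set ℂ := {z | (-1 < z.re ∧ z.re < 5) ∧ (-1 < z.im ∧ z.im < 4)}

/-- The closed rectangle `[-1, 5] × [-1, 4]`. [folklore] -/
def Rcl : Set ℂ := {z | (-1 ≤ z.re ∧ z.re ≤ 5) ∧ (-1 ≤ z.im ∧ z.im ≤ 4)}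

/-- The sites of the box `{0,…,4} × {0,…,3}`. [folklore] -/
def boxSet : Set (Site 2) := {x | (0 ≤ x 0 ∧ x 0 ≤ 4) ∧ (0 ≤ x 1 ∧ x 1 ≤ 3)}

/-- `convex_Rint` (auxiliary). [folklore] -/
theorem convex_Rint : Convex ℝ Rint := by
  have h : Rint = ({z : ℂ | (-1 : ℝ) < z.re} ∩ {z : ℂ | z.re < 5}) ∩ ({z : ℂ | (-1 : ℝ) < z.im} ∩ {z : ℂ | z.im < 4}) := by
    ext z; simp only [Rint, Set.mem_inter_iff, Set.mem_setOf_eq]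
  rw [h]
  exact ((convex_halfSpace_re_gt _).inter (convex_halfSpace_re_lt _)).inter
    ((convex_halfSpace_im_gt _).inter (convex_halfSpace_im_lt _))

/-- `isOpen_Rint` (auxiliary). [folklore] -/
theorem isOpen_Rint : IsOpen Rint := by
  have h : Rint = ({z : ℂ | (-1 : ℝ) < z.re} ∩ {z : ℂ | z.re < 5}) ∩ ({z : ℂ | (-1 : ℝ) < z.im} ∩ {z : ℂ | z.im < 4}) := by
    ext z; simp only [Rint, Set.mem_inter_iff, Set.mem_setOf_eq]
  rw [h]
  exact ((isOpen_lt continuous_const Complex.continuous_re).inter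
    (isOpen_lt Complex.continuous_re continuous_const)).inter
    ((isOpen_lt continuous_const Complex.continuous_im).inter
    (isOpen_lt Complex.continuous_im continuous_const))

/-- `convex_Rcl` (auxiliary). [folklore] -/
theorem convex_Rcl : Convex ℝ Rcl := by
  have h : Rcl = ({z : ℂ | (-1 : ℝ) ≤ z.re} ∩ {z : ℂ | z.re ≤ 5}) ∩ ({z : ℂ | (-1 : ℝ) ≤ z.im} ∩ {z : ℂ | z.im ≤ 4}) := by
    ext z; simp only [Rcl, Set.mem_inter_iff, Set.mem_setOf_eq]
  rw [h]
  exact ((convex_halfSpace_re_ge _).inter (convex_halfSpace_re_le _)).inter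
    ((convex_halfSpace_im_ge _).inter (convex_halfSpace_im_le _))

/-- `isClosed_Rcl` (auxiliary). [folklore] -/
theorem isClosed_Rcl : IsClosed Rcl := by
  have h : Rcl = ({z : ℂ | (-1 : ℝ) ≤ z.re} ∩ {z : ℂ | z.re ≤ 5}) ∩ ({z : ℂ | (-1 : ℝ) ≤ z.im} ∩ {z : ℂ | z.im ≤ 4}) := by
    ext z; simp only [Rcl, Set.mem_inter_iff, Set.mem_setOf_eq]
  rw [h]
  exact ((isClosed_le continuous_const Complex.continuous_re).inter
    (isClosed_le Complex.continuous_re continuous_const)).inter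
    ((isClosed_le continuous_const Complex.continuous_im).inter
    (isClosed_le Complex.continuous_im continuous_const))

/-- sanity: the crossing count of the boundary walk over the probe of the face `(0,0)`. [folklore] -/
theorem pathCross_Cwalk : pathCross 0 0 c₀ Cwalk.support.tail = -1 := by
  decide

/-! ### Winding numbers of the boundary walk -/

/-- Vertices of the boundary walk have height `≤ 4`. [folklore] -/
theorem Cwalk_support_le4 : ∀ x ∈ Cwalk.support, x 1 ≤ 4 := by decide

/-- `Cwalk_support_bounds` (auxiliary). [folklore] -/
theorem Cwalk_support_bounds :
    ∀ x ∈ Cwalk.support, (-1 ≤ x 0 ∧ x 0 ≤ 5) ∧ (-1 ≤ x 1 ∧ x 1 ≤ 4) := by decide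

/-- `Cwalk_isChain_bdry` (auxiliary). [folklore] -/
theorem Cwalk_isChain_bdry :
    List.IsChain (fun p q : Site 2 => (p 1 = -1 ∧ q 1 = -1) ∨ (p 0 = 5 ∧ q 0 = 5) ∨
      (p 1 = 4 ∧ q 1 = 4) ∨ (p 0 = -1 ∧ q 0 = -1)) (c₀ :: Cwalk.support.tail) := by decide

/-- The loop function of the crux for the boundary walk, as a `Path.extend`. [folklore] -/
theorem C_loop_apply (t : ℝ) :
    Set.IccExtend zero_le_one (Cwalk.toCurve (meshPoint 1)) t = (poly c₀ Cwalk.support.tail).extend t :=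
  iccExtend_toCurve_apply Cwalk t

/-- **The boundary walk winds once round the centre of the face `(0,0)`.** [folklore] -/
theorem wind_C_probe :
    wind (fun t : ℝ => (poly c₀ Cwalk.support.tail).extend t - probeL 0 0) = 1 := by
  have h := wind_poly_probeL (m := 0) (k := 0) (Y := 4) (by norm_num) c₀ Cwalk.support.tail
    (isChain_support (fun _ _ h => h) Cwalk) (by decide)
    (fun x hx => Cwalk_support_le4 x (List.mem_of_mem_tail hx)) (poly_fst_walk Cwalk)
  rw [pathCross_Cwalk] at h
  push_cast at h
  simp only [neg_neg] at h
  exact_mod_cast h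

/-- The four boundary lines. [folklore] -/
def Cbd : Set ℂ := {z | z.im = -1 ∨ z.re = 5 ∨ z.im = 4 ∨ z.re = -1}

/-- A polyline all of whose edges lie in `S` lies in `S`. [folklore] -/
theorem range_poly_subset_of_isChain {S : Set ℂ} :
    ∀ (a : Site 2) (l : List (Site 2)), pt a ∈ S →
      List.IsChain (fun x y => segment ℝ (pt x) (pt y) ⊆ S) (a :: l) → range (poly a l) ⊆ S
  | a, [], ha, _ => by rintro z ⟨t, rfl⟩; exact ha
  | a, b :: l, _, h => by
    rw [List.isChain_cons_cons] at h
    rw [range_poly_cons]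
    exact union_subset h.1 (range_poly_subset_of_isChain b l (h.1 (right_mem_segment _ _ _)) h.2)

/-- `segment_subset_Cbd` (auxiliary). [folklore] -/
theorem segment_subset_Cbd {p q : Site 2} (h : (p 1 = -1 ∧ q 1 = -1) ∨ (p 0 = 5 ∧ q 0 = 5) ∨
      (p 1 = 4 ∧ q 1 = 4) ∨ (p 0 = -1 ∧ q 0 = -1)) : segment ℝ (pt p) (pt q) ⊆ Cbd := by
  intro z hz
  simp only [Cbd, mem_setOf_eq]
  rcases h with ⟨hp, hq⟩ | ⟨hp, hq⟩ | ⟨hp, hq⟩ | ⟨hp, hq⟩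
  · left; rw [im_eq_of_mem_segment (by rw [hp, hq]) hz, hp]; norm_num
  · right; left; rw [re_eq_of_mem_segment (by rw [hp, hq]) hz, hp]; norm_num
  · right; right; left; rw [im_eq_of_mem_segment (by rw [hp, hq]) hz, hp]; norm_num
  · right; right; right; rw [re_eq_of_mem_segment (by rw [hp, hq]) hz, hp]; norm_num

/-- `range_C_subset_Cbd` (auxiliary). [folklore] -/
theorem range_C_subset_Cbd : range (poly c₀ Cwalk.support.tail) ⊆ Cbd :=
  range_poly_subset_of_isChain c₀ _ (by simp [Cbd, pt, bx]) (Cwalk_isChain_bdry.imp fun _ _ h => segment_subset_Cbd h)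

/-- `Cbd_subset_compl_Rint` (auxiliary). [folklore] -/
theorem Cbd_subset_compl_Rint : Cbd ⊆ Rintᶜ := by
  intro z hz hR
  simp only [Cbd, mem_setOf_eq] at hz
  obtain ⟨⟨h1, h2⟩, h3, h4⟩ := hR
  rcases hz with h | h | h | h <;> linarith

/-- `probeL00_mem_Rint` (auxiliary). [folklore] -/
theorem probeL00_mem_Rint : probeL 0 0 ∈ Rint := by
  simp only [Rint, mem_setOf_eq, probeL_re, probeL_im]; norm_num

/-- **Inside the rectangle the boundary walk winds once.** [folklore] -/
theorem wind_C_of_mem_Rint {z : ℂ} (hz : z ∈ Rint) :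
    wind (fun t : ℝ => (poly c₀ Cwalk.support.tail).extend t - z) = 1 := by
  rw [← wind_C_probe]
  symm
  set P := poly c₀ Cwalk.support.tail
  have hK : IsClosed Rintᶜ := isOpen_Rint.isClosed_compl
  have hmaps : MapsTo P.extend (Icc 0 1) Rintᶜ := fun t ht => by
    rw [Path.extend_apply P ht]
    exact Cbd_subset_compl_Rint (range_C_subset_Cbd ⟨_, rfl⟩)
  have h01 : P.extend 0 = P.extend 1 := by
    rw [Path.extend_zero, Path.extend_one, poly_fst_walk Cwalk]
  refine wind_sub_eq_of_mem_connectedComponentIn P.continuous_extend.continuousOn h01 hK hmaps ?_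
  rw [compl_compl]
  exact convex_Rint.isPreconnected.subset_connectedComponentIn probeL00_mem_Rint Subset.rfl hz

/-- `Rint_subset_Ωb` (auxiliary). [folklore] -/
theorem Rint_subset_Ωb : Rint ⊆ Ωb := fun z hz => by
  simp only [Ωb, mem_setOf_eq, C_loop_apply, wind_C_of_mem_Rint hz]; norm_num

/-- A loop does not wind round points of its own trace (junk value `0`). [folklore] -/
theorem wind_eq_zero_of_mem_range {x y : ℂ} (P : Path x y) {z : ℂ} (hz : z ∈ range P) :
    wind (fun t => P.extend t - z) = 0 := by
  obtain ⟨s, hs⟩ := hz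
  rw [wind, dif_neg]
  rintro ⟨hlog, -⟩
  refine hlog.ne_zero (x := (s : ℝ)) s.2 ?_
  simp only [Path.extend_apply P s.2, Subtype.coe_eta, hs, sub_self]

/-- `not_mem_Ωb_of_mem_support` (auxiliary). [folklore] -/
theorem not_mem_Ωb_of_mem_support {x : Site 2} (hx : x ∈ Cwalk.support) : pt x ∉ Ωb := by
  simp only [Ωb, mem_setOf_eq, not_not, C_loop_apply]
  apply wind_eq_zero_of_mem_range
  have hmem : pt x ∈ pt c₀ :: Cwalk.support.tail.map pt := by
    rw [← List.map_cons, Cwalk.cons_tail_support]; exact List.mem_map_of_mem hx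
  exact mem_range_polylineFrom _ _ hmem

/-- Far from a closed set containing the trace the winding number vanishes. [folklore] -/
theorem wind_poly_eq_zero_far (a : Site 2) (l : List (Site 2))
    (hend : (polylineFrom (pt a) (l.map pt)).1 = pt a) {K : Set ℂ} (hK : IsClosed K)
    (hr : range (poly a l) ⊆ K) {z : ℂ} (hz : z ∉ K)
    (hfar : ∀ M : ℝ, ∃ w, M < ‖w‖ ∧ segment ℝ z w ⊆ Kᶜ) :
    wind (fun t => (poly a l).extend t - z) = 0 := by
  set P := poly a l
  obtain ⟨M, hM⟩ := (isCompact_range P.continuous).isBounded.exists_norm_le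
  obtain ⟨w, hwM, hseg⟩ := hfar M
  have hmaps : MapsTo P.extend (Icc 0 1) K := fun t ht => by
    rw [Path.extend_apply P ht]; exact hr ⟨_, rfl⟩
  have hM' : ∀ t ∈ Icc (0 : ℝ) 1, ‖P.extend t‖ ≤ M := fun t ht => by
    rw [Path.extend_apply P ht]; exact hM _ ⟨_, rfl⟩
  have h01 : P.extend 0 = P.extend 1 := by rw [Path.extend_zero, Path.extend_one, hend]
  have hwc : w ∈ connectedComponentIn Kᶜ z :=
    (convex_segment _ _).isPreconnected.subset_connectedComponentIn (left_mem_segment _ _ _) hseg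
      (right_mem_segment _ _ _)
  exact wind_sub_eq_zero_of_joined P.continuous_extend.continuousOn h01 hK hmaps hM' hz hwc hwM

/-- `range_C_subset_Rcl` (auxiliary). [folklore] -/
theorem range_C_subset_Rcl : range (poly c₀ Cwalk.support.tail) ⊆ Rcl := by
  refine range_poly_subset convex_Rcl c₀ _ (by simp [Rcl, pt, bx]; norm_num) fun x hx => ?_
  obtain ⟨⟨h1, h2⟩, h3, h4⟩ := Cwalk_support_bounds x (List.mem_of_mem_tail hx)
  simp only [Rcl, mem_setOf_eq, pt_re, pt_im]
  refine ⟨⟨?_, ?_⟩, ?_, ?_⟩ <;> assumption_mod_cast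

/-- **Outside the closed rectangle the boundary walk does not wind.** [folklore] -/
theorem not_mem_Ωb_of_not_mem_Rcl {z : ℂ} (hz : z ∉ Rcl) : z ∉ Ωb := by
  simp only [Ωb, mem_setOf_eq, not_not, C_loop_apply]
  refine wind_poly_eq_zero_far c₀ _ (poly_fst_walk Cwalk) isClosed_Rcl range_C_subset_Rcl hz ?_
  intro M
  have hz' : (z.re < -1 ∨ 5 < z.re) ∨ (z.im < -1 ∨ 4 < z.im) := by
    simp only [Rcl, mem_setOf_eq, not_and_or, not_le] at hz
    exact hz
  rcases hz' with (h | h) | (h | h)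
  · refine ⟨⟨min z.re 0 - |M| - 1, z.im⟩, ?_, ?_⟩
    · have h1 := abs_re_le_norm (⟨min z.re 0 - |M| - 1, z.im⟩ : ℂ)
      have h2 : (⟨min z.re 0 - |M| - 1, z.im⟩ : ℂ).re = min z.re 0 - |M| - 1 := rfl
      rw [h2, abs_of_nonpos (by have := min_le_right z.re 0; have := abs_nonneg M; linarith)] at h1
      have := le_abs_self M; have := min_le_right z.re 0; linarith
    · intro y hy hyR
      obtain ⟨-, hhi⟩ := re_mem_of_mem_segment hy
      have hm : max z.re (min z.re 0 - |M| - 1) = z.re :=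
        max_eq_left (by have := min_le_left z.re 0; have := abs_nonneg M; linarith)
      rw [show (⟨min z.re 0 - |M| - 1, z.im⟩ : ℂ).re = min z.re 0 - |M| - 1 from rfl, hm] at hhi
      exact absurd hyR.1.1 (by linarith)
  · refine ⟨⟨max z.re 0 + |M| + 1, z.im⟩, ?_, ?_⟩
    · have h1 := abs_re_le_norm (⟨max z.re 0 + |M| + 1, z.im⟩ : ℂ)
      have h2 : (⟨max z.re 0 + |M| + 1, z.im⟩ : ℂ).re = max z.re 0 + |M| + 1 := rfl
      rw [h2, abs_of_nonneg (by have := le_max_right z.re 0; have := abs_nonneg M; linarith)] at h1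
      have := le_abs_self M; have := le_max_right z.re 0; linarith
    · intro y hy hyR
      obtain ⟨hlo, -⟩ := re_mem_of_mem_segment hy
      have hm : min z.re (max z.re 0 + |M| + 1) = z.re :=
        min_eq_left (by have := le_max_left z.re 0; have := abs_nonneg M; linarith)
      rw [show (⟨max z.re 0 + |M| + 1, z.im⟩ : ℂ).re = max z.re 0 + |M| + 1 from rfl, hm] at hlo
      exact absurd hyR.1.2 (by linarith)
  · refine ⟨⟨z.re, min z.im 0 - |M| - 1⟩, ?_, ?_⟩
    · have h1 := abs_im_le_norm (⟨z.re, min z.im 0 - |M| - 1⟩ : ℂ)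
      have h2 : (⟨z.re, min z.im 0 - |M| - 1⟩ : ℂ).im = min z.im 0 - |M| - 1 := rfl
      rw [h2, abs_of_nonpos (by have := min_le_right z.im 0; have := abs_nonneg M; linarith)] at h1
      have := le_abs_self M; have := min_le_right z.im 0; linarith
    · intro y hy hyR
      obtain ⟨-, hhi⟩ := im_mem_of_mem_segment hy
      have hm : max z.im (min z.im 0 - |M| - 1) = z.im :=
        max_eq_left (by have := min_le_left z.im 0; have := abs_nonneg M; linarith)
      rw [show (⟨z.re, min z.im 0 - |M| - 1⟩ : ℂ).im = min z.im 0 - |M| - 1 from rfl, hm] at hhi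
      exact absurd hyR.2.1 (by linarith)
  · refine ⟨⟨z.re, max z.im 0 + |M| + 1⟩, ?_, ?_⟩
    · have h1 := abs_im_le_norm (⟨z.re, max z.im 0 + |M| + 1⟩ : ℂ)
      have h2 : (⟨z.re, max z.im 0 + |M| + 1⟩ : ℂ).im = max z.im 0 + |M| + 1 := rfl
      rw [h2, abs_of_nonneg (by have := le_max_right z.im 0; have := abs_nonneg M; linarith)] at h1
      have := le_abs_self M; have := le_max_right z.im 0; linarith
    · intro y hy hyR
      obtain ⟨hlo, -⟩ := im_mem_of_mem_segment hy
      have hm : min z.im (max z.im 0 + |M| + 1) = z.im :=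
        min_eq_left (by have := le_max_left z.im 0; have := abs_nonneg M; linarith)
      rw [show (⟨z.re, max z.im 0 + |M| + 1⟩ : ℂ).im = max z.im 0 + |M| + 1 from rfl, hm] at hlo
      exact absurd hyR.2.2 (by linarith)

/-- The lattice points of the boundary are vertices of the boundary walk. [folklore] -/
theorem mem_support_of_bdry (i j : ℤ) (hi : -1 ≤ i) (hi' : i ≤ 5) (hj : -1 ≤ j) (hj' : j ≤ 4)
    (hb : i = -1 ∨ i = 5 ∨ j = -1 ∨ j = 4) : bx i j ∈ Cwalk.support := by
  interval_cases i <;> interval_cases j <;> first | decide | (exfalso; omega)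

/-- **The mesh vertices of `Ω` are exactly the sites of the `5 × 4` box.** [folklore] -/
theorem meshVertices_Ωb : meshVertices Ωb 1 = boxSet := by
  ext x
  rw [mem_meshVertices_iff, meshPoint_one]
  constructor
  · intro hx
    by_contra hbox
    by_cases hR : pt x ∈ Rcl
    · obtain ⟨⟨h1, h2⟩, h3, h4⟩ := hR
      simp only [pt_re, pt_im] at h1 h2 h3 h4
      have i1 : -1 ≤ x 0 := by exact_mod_cast h1
      have i2 : x 0 ≤ 5 := by exact_mod_cast h2
      have i3 : -1 ≤ x 1 := by exact_mod_cast h3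
      have i4 : x 1 ≤ 4 := by exact_mod_cast h4
      have hb : x 0 = -1 ∨ x 0 = 5 ∨ x 1 = -1 ∨ x 1 = 4 := by
        simp only [boxSet, mem_setOf_eq] at hbox; omega
      have hmem := mem_support_of_bdry (x 0) (x 1) i1 i2 i3 i4 hb
      rw [← eq_bx x] at hmem
      exact not_mem_Ωb_of_mem_support hmem hx
    · exact not_mem_Ωb_of_not_mem_Rcl hR hx
  · intro hx
    obtain ⟨⟨h1, h2⟩, h3, h4⟩ := hx
    apply Rint_subset_Ωb
    simp only [Rint, mem_setOf_eq, pt_re, pt_im]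
    have i1 : (0 : ℝ) ≤ x 0 := by exact_mod_cast h1
    have i2 : (x 0 : ℝ) ≤ 4 := by exact_mod_cast h2
    have i3 : (0 : ℝ) ≤ x 1 := by exact_mod_cast h3
    have i4 : (x 1 : ℝ) ≤ 3 := by exact_mod_cast h4
    refine ⟨⟨by linarith, by linarith⟩, by linarith, by linarith⟩

end BoxDomain

end Summit.CriticalPhenomena.SAWScalingLimit.Theorems.LeftRightFKG.Negative
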